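import Summits.Parity.BatemanHorn.Theorems.SoloBlindAlignmentGeneral

/-!
# Alignment is EXACT for every quadratic progression (solo-blind programme, session 8)

Companion to `SoloBlindAlignmentGeneral` (pairing lemma: for a general injective `v` a fraction `1/D`
of the trivial bound survives alignment, `D` = the largest fibre) and to `SoloBlindAlignment`
(`v(k) = k² + 1`, where every fibre is a singleton and NOTHING is saved).  Here the singleton-fibre
phenomenon is proved for EVERY quadratic `v(k) = a k² + b k + c` with `a ≥ 1`, `b, c ∈ ℕ` (any integer
quadratic with positive leading coefficient, re-centred past its turning point) and prime moduli
`p > 2 a x + b`: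

* `quad_prime_unique` — such a prime divides `v(k)` for at most ONE index `k ≤ x`, because
  `v(k') − v(k) = (k' − k) · (a (k + k') + b)` with both factors in `(0, p)`;
* `card_fibre_le_one` — hence every fibre of the edge structure has at most one element;
* `bilin_aligned_eq_edgeCount`, `alignment_exact` — for fibres of size `≤ 1` and ANY unimodular
  cofactor coefficient `ξ`, the aligned modulus coefficient `κ(ξ)_p = sign (fibre sum)` gives
  `B(ξ, κ(ξ)) = E = T(ξ, κ(ξ))`: the bilinear ("Type II") sum attains its trivial bound exactly, in every
  range of the variables at once — so a bilinear-forms hypothesis with FREE bounded coefficients and a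
  logarithmic saving is false for the progression `v([0, x])` as soon as it has edges (`E ≥ 1`; for
  `k² + 1`, `E ≥ (1/2 − o(1)) x` is `SoloBlindChebyshev`);
* `card_rough_le_edgeCount` — the edge supply is at least the number of `k ≤ x` whose value has a prime
  factor `> 2 a x + b`.

Mathlib only (through the imported framework file); no `sorry`.
-/

open Finset

namespace Summit.Parity.BatemanHorn.Theorems.SoloBlindAlignmentQuadratic

open Summit.Parity.BatemanHorn.Theorems.SoloBlindAlignmentGeneral

/-! ## One index per large prime -/

/-- The ordered case: for `k < k' ≤ x` a prime `p > 2 a x + b` cannot divide both `v(k)` and `v(k')`. -/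
theorem quad_prime_not_lt {a b c x p k k' : ℕ} (hp : p.Prime) (ha : 0 < a)
    (hpx : 2 * a * x + b < p) (hk' : k' ≤ x)
    (hdk : p ∣ a * k ^ 2 + b * k + c) (hdk' : p ∣ a * k' ^ 2 + b * k' + c) : ¬ k < k' := by
  intro hlt
  obtain ⟨d, rfl⟩ := Nat.exists_eq_add_of_le hlt.le
  have hd : 0 < d := by omega
  have hv : a * (k + d) ^ 2 + b * (k + d) + c
      = (a * k ^ 2 + b * k + c) + d * (a * (2 * k + d) + b) := by ring
  have h2 : p ∣ d * (a * (2 * k + d) + b) := by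
    have h := hdk'
    rw [hv] at h
    exact (Nat.dvd_add_right hdk).mp h
  have hx : x ≤ 2 * a * x := Nat.le_mul_of_pos_left x (by omega)
  rcases (Nat.Prime.dvd_mul hp).mp h2 with h | h
  · -- `p ≤ d ≤ x ≤ 2 a x ≤ 2 a x + b < p`
    have h1 : p ≤ d := Nat.le_of_dvd hd h
    have h3 : d ≤ x := by omega
    exact absurd (lt_of_le_of_lt ((h1.trans h3).trans (hx.trans (Nat.le_add_right _ b))) hpx)
      (lt_irrefl p)
  · -- `p ≤ a (2k + d) + b ≤ 2 a x + b < p`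
    have hpos : 0 < a * (2 * k + d) + b := Nat.add_pos_left (Nat.mul_pos ha (by omega)) b
    have h1 : p ≤ a * (2 * k + d) + b := Nat.le_of_dvd hpos h
    have h2k : 2 * k + d ≤ 2 * x := by omega
    have h3 : a * (2 * k + d) + b ≤ 2 * a * x + b := by
      have := Nat.mul_le_mul_left a h2k
      have e : a * (2 * x) = 2 * a * x := by ring
      omega
    exact absurd (lt_of_le_of_lt (h1.trans h3) hpx) (lt_irrefl p)

/-- **One index per large prime.** For `v(k) = a k² + b k + c` (`a ≥ 1`) and a prime `p > 2 a x + b`,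
at most one `k ≤ x` has `p ∣ v(k)`. -/
theorem quad_prime_unique {a b c x p k k' : ℕ} (hp : p.Prime) (ha : 0 < a)
    (hpx : 2 * a * x + b < p) (hk : k ≤ x) (hk' : k' ≤ x)
    (hdk : p ∣ a * k ^ 2 + b * k + c) (hdk' : p ∣ a * k' ^ 2 + b * k' + c) : k = k' := by
  rcases lt_trichotomy k k' with hlt | heq | hgt
  · exact absurd hlt (quad_prime_not_lt hp ha hpx hk' hdk hdk')
  · exact heq
  · exact absurd hgt (quad_prime_not_lt hp ha hpx hk hdk' hdk)

/-- Hence every fibre of an edge structure built from such primes has at most one element. -/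
theorem card_fibre_le_one {a b c x : ℕ} (ha : 0 < a) {N : ℕ → Finset ℕ}
    (hN : ∀ k, ∀ p ∈ N k, p.Prime ∧ 2 * a * x + b < p ∧ p ∣ a * k ^ 2 + b * k + c) (n : ℕ) :
    (fibre x N n).card ≤ 1 := by
  rw [Finset.card_le_one]
  intro k hk k' hk'
  simp only [fibre, Finset.mem_filter, Finset.mem_range] at hk hk'
  obtain ⟨hp, hpx, hdk⟩ := hN k n hk.2
  obtain ⟨-, -, hdk'⟩ := hN k' n hk'.2
  exact quad_prime_unique hp ha hpx (by omega) (by omega) hdk hdk'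

/-! ## Singleton fibres: the aligned form attains the trivial bound exactly -/

/-- On a fibre of size `≤ 1` the fibre sum of a unimodular `ξ` has absolute value `#fibre`. -/
theorem abs_fibreSum_eq_card (x : ℕ) (v : ℕ → ℕ) {N : ℕ → Finset ℕ} {ξ : ℕ → ℤ}
    (hξ : ∀ m, |ξ m| = 1) {n : ℕ} (hn : (fibre x N n).card ≤ 1) :
    |fibreSum x v N ξ n| = ((fibre x N n).card : ℤ) := by
  unfold fibreSum
  rcases (fibre x N n).eq_empty_or_nonempty with h | ⟨k, hk⟩
  · simp [h]
  · have hs : fibre x N n = {k} :=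
      Finset.eq_singleton_iff_unique_mem.mpr ⟨hk, fun k' hk' => Finset.card_le_one.mp hn k' hk' k hk⟩
    simp [hs, hξ]

/-- `T(ξ, η) ≤ E` for bounded coefficients. -/
theorem trivialBound_le_edgeCount (x : ℕ) (v : ℕ → ℕ) (N : ℕ → Finset ℕ) {ξ η : ℕ → ℤ}
    (hξ : ∀ m, |ξ m| ≤ 1) (hη : ∀ n, |η n| ≤ 1) :
    trivialBound x v N ξ η ≤ (edgeCount x N : ℤ) := by
  unfold trivialBound edgeCount
  push_cast
  refine Finset.sum_le_sum fun k _ => ?_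
  rw [Finset.card_eq_sum_ones]
  push_cast
  refine Finset.sum_le_sum fun n _ => ?_
  calc |ξ (v k / n)| * |η n| ≤ 1 * 1 := mul_le_mul (hξ _) (hη _) (abs_nonneg _) zero_le_one
    _ = 1 := one_mul 1

/-- With singleton fibres and unimodular `ξ`: `B(ξ, κ(ξ)) = E`. -/
theorem bilin_aligned_eq_edgeCount (x : ℕ) (v : ℕ → ℕ) {N : ℕ → Finset ℕ} {ξ : ℕ → ℤ}
    (hξ : ∀ m, |ξ m| = 1) (hfib : ∀ n, (fibre x N n).card ≤ 1) :
    bilin x v N ξ (aligned x v N ξ) = (edgeCount x N : ℤ) := by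
  rw [bilin_aligned_eq_sum_abs, edgeCount_eq_sum_card_fibre]
  push_cast
  exact Finset.sum_congr rfl fun n _ => abs_fibreSum_eq_card x v hξ (hfib n)

/-- **Exact alignment.** With singleton fibres, for EVERY unimodular `ξ` the aligned coefficient gives
`B(ξ, κ(ξ)) = E = T(ξ, κ(ξ))` — no cancellation whatsoever. -/
theorem alignment_exact (x : ℕ) (v : ℕ → ℕ) {N : ℕ → Finset ℕ} {ξ : ℕ → ℤ}
    (hξ : ∀ m, |ξ m| = 1) (hfib : ∀ n, (fibre x N n).card ≤ 1) :
    bilin x v N ξ (aligned x v N ξ) = (edgeCount x N : ℤ) ∧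
      trivialBound x v N ξ (aligned x v N ξ) = (edgeCount x N : ℤ) := by
  have hB := bilin_aligned_eq_edgeCount x v hξ hfib
  refine ⟨hB, le_antisymm ?_ ?_⟩
  · exact trivialBound_le_edgeCount x v N (fun m => (hξ m).le) (abs_aligned_le_one x v N ξ)
  · calc (edgeCount x N : ℤ) = bilin x v N ξ (aligned x v N ξ) := hB.symm
      _ ≤ |bilin x v N ξ (aligned x v N ξ)| := le_abs_self _
      _ ≤ trivialBound x v N ξ (aligned x v N ξ) := abs_bilin_le_trivialBound x v N ξ _

/-! ## The quadratic edge structure -/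

/-- The large prime factors of `v(k) = a k² + b k + c`: primes `p > 2 a x + b` dividing `v(k)`. -/
def bigPrimes (a b c x k : ℕ) : Finset ℕ :=
  (a * k ^ 2 + b * k + c).primeFactors.filter (fun p => 2 * a * x + b < p)

/-- Every selected modulus is a prime `> 2 a x + b` dividing `v(k)`. -/
theorem bigPrimes_spec (a b c x : ℕ) :
    ∀ k, ∀ p ∈ bigPrimes a b c x k, p.Prime ∧ 2 * a * x + b < p ∧ p ∣ a * k ^ 2 + b * k + c := by
  intro k p hp
  simp only [bigPrimes, Finset.mem_filter, Nat.mem_primeFactors] at hp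
  exact ⟨hp.1.1, hp.2, hp.1.2.1⟩

/-- **Exact alignment for every quadratic.** For `v(k) = a k² + b k + c` (`a ≥ 1`), moduli = the primes
`p > 2 a x + b` dividing `v(k)`, and EVERY unimodular cofactor coefficient `ξ`:
`B(ξ, κ(ξ)) = E = T(ξ, κ(ξ))`. -/
theorem quadratic_alignment_exact {a : ℕ} (b c x : ℕ) (ha : 0 < a) {ξ : ℕ → ℤ}
    (hξ : ∀ m, |ξ m| = 1) :
    bilin x (fun k => a * k ^ 2 + b * k + c) (bigPrimes a b c x) ξ
        (aligned x (fun k => a * k ^ 2 + b * k + c) (bigPrimes a b c x) ξ)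
        = (edgeCount x (bigPrimes a b c x) : ℤ) ∧
      trivialBound x (fun k => a * k ^ 2 + b * k + c) (bigPrimes a b c x) ξ
        (aligned x (fun k => a * k ^ 2 + b * k + c) (bigPrimes a b c x) ξ)
        = (edgeCount x (bigPrimes a b c x) : ℤ) :=
  alignment_exact x _ hξ (card_fibre_le_one ha (bigPrimes_spec a b c x))

/-- The same for any SUB-selection of those primes (e.g. a window `p ∈ (2 a x + b, P]`): fibres only shrink. -/
theorem quadratic_alignment_exact_of_subset {a : ℕ} (b c x : ℕ) (ha : 0 < a) {N : ℕ → Finset ℕ}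
    (hN : ∀ k, N k ⊆ bigPrimes a b c x k) {ξ : ℕ → ℤ} (hξ : ∀ m, |ξ m| = 1) :
    bilin x (fun k => a * k ^ 2 + b * k + c) N ξ (aligned x (fun k => a * k ^ 2 + b * k + c) N ξ)
        = (edgeCount x N : ℤ) ∧
      trivialBound x (fun k => a * k ^ 2 + b * k + c) N ξ
        (aligned x (fun k => a * k ^ 2 + b * k + c) N ξ) = (edgeCount x N : ℤ) :=
  alignment_exact x _ hξ
    (card_fibre_le_one ha (fun k p hp => bigPrimes_spec a b c x k p (hN k hp)))

/-- Edge supply: `E ≥ #{k ≤ x : v(k) has a prime factor > 2 a x + b}`. -/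
theorem card_rough_le_edgeCount (a b c x : ℕ) :
    ((range (x + 1)).filter (fun k => (bigPrimes a b c x k).Nonempty)).card
      ≤ edgeCount x (bigPrimes a b c x) := by
  unfold edgeCount
  rw [Finset.card_eq_sum_ones, Finset.sum_filter]
  refine Finset.sum_le_sum fun k _ => ?_
  split_ifs with h
  · exact Finset.card_pos.mpr h
  · exact Nat.zero_le _

end Summit.Parity.BatemanHorn.Theorems.SoloBlindAlignmentQuadratic
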